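import Mathlib
import HarnessLib

/-!
# Route `DeformationLadder` — crux `LowEnergyRigidity` (stmt-HubbardSuperconductivity-1892),
# crux idea `heavy-condensate-fibration`: smooth plateau cutoffs with summable Fourier series

The real-analysis input of the smooth cutoff pair (`SmoothCutoffBound` of the card): on a spectral
window `[0, Λ]` there are SMOOTH real functions `f, g` with `f² + g² = 1`, `f = 0` on `[2a, Λ]`,
`a g² ≤ x` (so `g = 0` on `[0, a]`), both represented on `[0, Λ]` by trigonometric series
`Σ_k c_k e^{ikωx}` with `Σ_k |k| ‖c_k‖ < ∞` (`hcf_plateau_cutoff_functions`). Construction: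
`f = cos(π/2 · S((x-a)/a))`, `g = sin(π/2 · S((x-a)/a))` with Mathlib's `Real.smoothTransition` `S`,
multiplied by far-away smooth cutoffs so that they vanish near the ends of a larger window, whose
Fourier coefficients then decay like `|k|⁻³` by three integrations by parts
(`fourierCoeffOn_of_hasDerivAt`) and whose Fourier series converge pointwise
(`has_pointwise_sum_fourier_series_of_summable`): `hcf_fourier_window`.

Reference: Katznelson, *An Introduction to Harmonic Analysis*, I.§4 (smoothness ⇒ coefficient decay;
absolutely convergent Fourier series of `C²` functions). [folklore]
-/

namespace Summit.HubbardSuperconductivity.HubbardSuperconductivity.Theorems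

set_option linter.dupNamespace false

open Complex Set Filter MeasureTheory
open scoped Real Topology

section Window

/-- One integration by parts on a window `[a₀, a₀ + T]` without boundary terms: if `F' = G`
with `G` continuous and `F a₀ = F (a₀ + T)`, then `‖ĉ_F(n)‖ = T/(2π|n|) · ‖ĉ_G(n)‖` for `n ≠ 0`
(`fourierCoeffOn`). [folklore] -/
theorem hcf_norm_fourierCoeffOn_of_hasDerivAt {a₀ T : ℝ} (hT : 0 < T) {F G : ℝ → ℂ}
    (hFG : ∀ x, HasDerivAt F (G x) x) (hG : Continuous G) (hF : F a₀ = F (a₀ + T)) {n : ℤ}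
    (hn : n ≠ 0) :
    ‖fourierCoeffOn (lt_add_of_pos_right a₀ hT) F n‖ =
      T / (2 * π * |(n : ℝ)|) * ‖fourierCoeffOn (lt_add_of_pos_right a₀ hT) G n‖ := by
  have h := fourierCoeffOn_of_hasDerivAt (lt_add_of_pos_right a₀ hT) hn (fun x _ => hFG x)
    (hG.intervalIntegrable _ _)
  rw [hF, sub_self, mul_zero, zero_sub] at h
  have hT' : ((a₀ + T : ℝ) : ℂ) - (a₀ : ℂ) = (T : ℂ) := by push_cast; ring
  rw [hT'] at h
  rw [h, norm_mul, norm_neg, norm_mul, Complex.norm_real, Real.norm_eq_abs, abs_of_pos hT, norm_div,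
    norm_one]
  have hden : ‖(-2 * (π : ℂ) * Complex.I * n)‖ = 2 * π * |(n : ℝ)| := by
    rw [norm_mul, norm_mul, norm_mul, norm_neg, Complex.norm_I, mul_one, Complex.norm_intCast,
      Complex.norm_ofNat, Complex.norm_real, Real.norm_eq_abs, abs_of_pos Real.pi_pos]
  rw [hden]
  ring

/-- The window Fourier coefficients of a continuous function are bounded by its sup:
`‖ĉ_G(n)‖ ≤ M` if `‖G‖ ≤ M` on `[a₀, a₀ + T]`. [folklore] -/
theorem hcf_norm_fourierCoeffOn_le {a₀ T : ℝ} (hT : 0 < T) {G : ℝ → ℂ} {M : ℝ}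
    (hM : ∀ x ∈ Icc a₀ (a₀ + T), ‖G x‖ ≤ M) (n : ℤ) :
    ‖fourierCoeffOn (lt_add_of_pos_right a₀ hT) G n‖ ≤ M := by
  rw [fourierCoeffOn_eq_integral, norm_smul]
  have hint : ‖∫ x in a₀..a₀ + T, (fourier (-n)) (x : AddCircle (a₀ + T - a₀)) • G x‖ ≤
      M * |a₀ + T - a₀| := by
    refine intervalIntegral.norm_integral_le_of_norm_le_const fun x hx => ?_
    rw [uIoc_of_le (lt_add_of_pos_right a₀ hT).le] at hx
    rw [norm_smul, fourier_apply, Circle.norm_coe, one_mul]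
    exact hM x (Ioc_subset_Icc_self hx)
  have hM0 : 0 ≤ M := (norm_nonneg _).trans (hM a₀ (left_mem_Icc.2 (by linarith)))
  calc ‖(1 / (a₀ + T - a₀) : ℝ)‖ * ‖∫ x in a₀..a₀ + T, (fourier (-n)) (x : AddCircle (a₀ + T - a₀)) • G x‖
      ≤ ‖(1 / (a₀ + T - a₀) : ℝ)‖ * (M * |a₀ + T - a₀|) :=
        mul_le_mul_of_nonneg_left hint (norm_nonneg _)
    _ = M := by
        rw [add_sub_cancel_left, Real.norm_eq_abs, abs_of_pos (by positivity), abs_of_pos hT]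
        field_simp

/-- **Fourier series of a smooth function vanishing near the ends of a window.** If `h : ℝ → ℝ` is
smooth and vanishes in neighbourhoods of `a₀` and of `a₀ + T` (`T > 0`), then its window Fourier
coefficients `c_k = fourierCoeffOn [a₀, a₀+T] h k` satisfy `Σ_k ‖c_k‖ |k| < ∞` (three integrations
by parts, `|c_k| ≤ (T/2π)³ sup|h'''| / |k|³`) and the Fourier series converges to `h` on the window:
`h(x) = Σ_k c_k e^{ik(2π/T)x}` for `x ∈ [a₀, a₀ + T)`. Katznelson I.§4. [folklore] -/
theorem hcf_fourier_window {h : ℝ → ℝ} (hh : ContDiff ℝ (⊤ : ℕ∞) h) {a₀ T : ℝ} (hT : 0 < T)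
    (h0 : ∀ᶠ x in 𝓝 a₀, h x = 0) (h1 : ∀ᶠ x in 𝓝 (a₀ + T), h x = 0) (ω : ℝ) (hω : ω = 2 * π / T) :
    (Summable fun k : ℤ =>
        ‖fourierCoeffOn (lt_add_of_pos_right a₀ hT) (fun x => ((h x : ℝ) : ℂ)) k‖ * |(k : ℝ)|) ∧
      ∀ x ∈ Ico a₀ (a₀ + T),
        HasSum (fun k : ℤ => fourierCoeffOn (lt_add_of_pos_right a₀ hT) (fun x => ((h x : ℝ) : ℂ)) k *
          Complex.exp (Complex.I * ((k : ℝ) * ω * x))) ((h x : ℝ) : ℂ) := by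
  -- derivatives of `h`
  have hd0 : Differentiable ℝ h := (contDiff_infty_iff_deriv.1 hh).1
  have hh1 : ContDiff ℝ (⊤ : ℕ∞) (deriv h) := (contDiff_infty_iff_deriv.1 hh).2
  have hd1 : Differentiable ℝ (deriv h) := (contDiff_infty_iff_deriv.1 hh1).1
  have hh2 : ContDiff ℝ (⊤ : ℕ∞) (deriv (deriv h)) := (contDiff_infty_iff_deriv.1 hh1).2
  have hd2 : Differentiable ℝ (deriv (deriv h)) := (contDiff_infty_iff_deriv.1 hh2).1
  have hh3 : ContDiff ℝ (⊤ : ℕ∞) (deriv (deriv (deriv h))) := (contDiff_infty_iff_deriv.1 hh2).2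
  have hc3 : Continuous (deriv (deriv (deriv h))) := hh3.continuous
  -- vanishing of `h, h', h''` at both ends
  have hz : ∀ {b : ℝ}, (∀ᶠ x in 𝓝 b, h x = 0) →
      h b = 0 ∧ deriv h b = 0 ∧ deriv (deriv h) b = 0 := by
    intro b hb
    have hb' : h =ᶠ[𝓝 b] fun _ => (0 : ℝ) := hb
    have hb1 : deriv h =ᶠ[𝓝 b] fun _ => (0 : ℝ) := by
      have := hb'.deriv
      rwa [deriv_const'] at this
    have hb2 : deriv (deriv h) =ᶠ[𝓝 b] fun _ => (0 : ℝ) := by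
      have := hb1.deriv
      rwa [deriv_const'] at this
    exact ⟨hb'.eq_of_nhds, hb1.eq_of_nhds, hb2.eq_of_nhds⟩
  obtain ⟨hz0, hz0', hz0''⟩ := hz h0
  obtain ⟨hz1, hz1', hz1''⟩ := hz h1
  -- complexified functions
  set H : ℝ → ℂ := fun x => ((h x : ℝ) : ℂ) with hH
  set H1 : ℝ → ℂ := fun x => ((deriv h x : ℝ) : ℂ) with hH1
  set H2 : ℝ → ℂ := fun x => ((deriv (deriv h) x : ℝ) : ℂ) with hH2
  set H3 : ℝ → ℂ := fun x => ((deriv (deriv (deriv h)) x : ℝ) : ℂ) with hH3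
  have hD0 : ∀ x, HasDerivAt H (H1 x) x := fun x => (hd0 x).hasDerivAt.ofReal_comp
  have hD1 : ∀ x, HasDerivAt H1 (H2 x) x := fun x => (hd1 x).hasDerivAt.ofReal_comp
  have hD2 : ∀ x, HasDerivAt H2 (H3 x) x := fun x => (hd2 x).hasDerivAt.ofReal_comp
  have hC1 : Continuous H1 := Complex.continuous_ofReal.comp hh1.continuous
  have hC2 : Continuous H2 := Complex.continuous_ofReal.comp hh2.continuous
  have hC3 : Continuous H3 := Complex.continuous_ofReal.comp hc3
  set c := fourierCoeffOn (lt_add_of_pos_right a₀ hT) H with hc_def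
  -- a bound on `h'''` on the window
  obtain ⟨M, hM⟩ := isCompact_Icc.exists_bound_of_continuousOn (s := Icc a₀ (a₀ + T)) hC3.continuousOn
  have hM0 : 0 ≤ M := (norm_nonneg _).trans (hM a₀ (left_mem_Icc.2 (by linarith)))
  -- the decay `‖c k‖ ≤ (T/(2π|k|))³ M`
  have hdecay : ∀ k : ℤ, k ≠ 0 → ‖c k‖ ≤ (T / (2 * π * |(k : ℝ)|)) ^ 3 * M := by
    intro k hk
    have hE0 : H a₀ = H (a₀ + T) := by
      show ((h a₀ : ℝ) : ℂ) = ((h (a₀ + T) : ℝ) : ℂ)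
      rw [hz0, hz1]
    have hE1 : H1 a₀ = H1 (a₀ + T) := by
      show ((deriv h a₀ : ℝ) : ℂ) = ((deriv h (a₀ + T) : ℝ) : ℂ)
      rw [hz0', hz1']
    have hE2 : H2 a₀ = H2 (a₀ + T) := by
      show ((deriv (deriv h) a₀ : ℝ) : ℂ) = ((deriv (deriv h) (a₀ + T) : ℝ) : ℂ)
      rw [hz0'', hz1'']
    have e0 := hcf_norm_fourierCoeffOn_of_hasDerivAt hT hD0 hC1 hE0 hk
    have e1 := hcf_norm_fourierCoeffOn_of_hasDerivAt hT hD1 hC2 hE1 hk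
    have e2 := hcf_norm_fourierCoeffOn_of_hasDerivAt hT hD2 hC3 hE2 hk
    have e3 := hcf_norm_fourierCoeffOn_le hT (G := H3) hM k
    have hq : 0 ≤ T / (2 * π * |(k : ℝ)|) := by positivity
    rw [hc_def, e0, e1, e2]
    calc T / (2 * π * |(k : ℝ)|) * (T / (2 * π * |(k : ℝ)|) * (T / (2 * π * |(k : ℝ)|) *
          ‖fourierCoeffOn (lt_add_of_pos_right a₀ hT) H3 k‖))
        ≤ T / (2 * π * |(k : ℝ)|) * (T / (2 * π * |(k : ℝ)|) * (T / (2 * π * |(k : ℝ)|) * M)) := by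
          gcongr
      _ = (T / (2 * π * |(k : ℝ)|)) ^ 3 * M := by ring
  -- summability of `‖c k‖ |k|`
  set C₀ : ℝ := (T / (2 * π)) ^ 3 * M with hC₀
  have hC₀0 : 0 ≤ C₀ := by positivity
  have hbound : ∀ k : ℤ, ‖c k‖ * |(k : ℝ)| ≤ C₀ * (1 / (k : ℝ) ^ 2) := by
    intro k
    by_cases hk : k = 0
    · subst hk
      simp
    · have hk' : (0 : ℝ) < |(k : ℝ)| := abs_pos.2 (Int.cast_ne_zero.2 hk)
      calc ‖c k‖ * |(k : ℝ)| ≤ (T / (2 * π * |(k : ℝ)|)) ^ 3 * M * |(k : ℝ)| :=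
            mul_le_mul_of_nonneg_right (hdecay k hk) (abs_nonneg _)
        _ = C₀ * (1 / (k : ℝ) ^ 2) := by
            rw [hC₀, ← sq_abs (k : ℝ)]
            field_simp
  have hsum1 : Summable fun k : ℤ => ‖c k‖ * |(k : ℝ)| :=
    Summable.of_nonneg_of_le (fun k => by positivity) hbound
      ((Real.summable_one_div_int_pow.2 (by norm_num : 1 < 2)).mul_left C₀)
  refine ⟨hsum1, ?_⟩
  -- summability of `‖c k‖` itself
  have hsum0 : Summable fun k : ℤ => ‖c k‖ := by
    have hle : ∀ k : ℤ, ‖c k‖ ≤ ‖c k‖ * |(k : ℝ)| + (if k = 0 then ‖c 0‖ else 0) := by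
      intro k
      by_cases hk : k = 0
      · subst hk; simp
      · rw [if_neg hk, add_zero]
        have h1 : (1 : ℝ) ≤ |(k : ℝ)| := by
          rw [← Int.cast_abs]
          exact_mod_cast Int.one_le_abs hk
        nlinarith [norm_nonneg (c k)]
    refine Summable.of_nonneg_of_le (fun k => norm_nonneg _) hle (hsum1.add ?_)
    exact (hasSum_ite_eq (0 : ℤ) ‖c 0‖).summable
  -- the continuous periodic lift and pointwise convergence
  haveI : Fact (0 < T) := ⟨hT⟩
  have hHc : Continuous H := Complex.continuous_ofReal.comp hh.continuous
  have hends : H a₀ = H (a₀ + T) := by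
    show ((h a₀ : ℝ) : ℂ) = ((h (a₀ + T) : ℝ) : ℂ)
    rw [hz0, hz1]
  set Fc : C(AddCircle T, ℂ) := ⟨AddCircle.liftIco T a₀ H, AddCircle.liftIco_continuous hends hHc.continuousOn⟩
    with hFc
  have hcoef : fourierCoeff (⇑Fc) = c := by
    funext k
    exact fourierCoeff_liftIco_eq H k
  have hsumF : Summable (fourierCoeff (⇑Fc)) := by
    rw [hcoef]
    exact hsum0.of_norm
  intro x hx
  have hpt := has_pointwise_sum_fourier_series_of_summable hsumF (x : AddCircle T)
  have hFx : Fc (x : AddCircle T) = H x := by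
    simp only [hFc, ContinuousMap.coe_mk]
    exact AddCircle.liftIco_coe_apply hx
  rw [hFx, hcoef] at hpt
  convert hpt using 1
  funext k
  rw [smul_eq_mul, fourier_coe_apply, hω]
  congr 1
  push_cast
  ring

end Window

/-! ### The plateau pair -/

section Plateau

/-- **Smooth plateau cutoffs with summable Fourier series** (the real-analysis input of the card's
`SmoothCutoffBound`): for `a > 0` and a spectral window `[0, Λ]` there are real functions `f, g`
and trigonometric data `(c^f, c^g, ω)` with, for all `x ∈ [0, Λ]`: `f(x)² + g(x)² = 1`, `f(x) = 0`
if `x ≥ 2a`, `a g(x)² ≤ x` (Markov domination; in particular `g = 0` on `[0,a]`), and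
`f(x) = Σ_k c^f_k e^{ikωx}`, `g(x) = Σ_k c^g_k e^{ikωx}` with `Σ_k |k| ‖c^f_k‖, Σ_k |k| ‖c^g_k‖ < ∞`.
(`f = cos(π/2·S((x-a)/a))`, `g = sin(π/2·S((x-a)/a))`, `S = Real.smoothTransition`, localised by
far-away cutoffs and expanded on the window `[-(Λ+4a), Λ+4a)` by `hcf_fourier_window`.) [folklore] -/
theorem hcf_plateau_cutoff_functions {a Λ : ℝ} (ha : 0 < a) (hΛ : 0 < Λ) :
    ∃ (f g : ℝ → ℝ) (cf cg : ℤ → ℂ) (ω : ℝ),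
      (∀ x ∈ Icc 0 Λ, f x ^ 2 + g x ^ 2 = 1) ∧
      (∀ x ∈ Icc 0 Λ, 2 * a ≤ x → f x = 0) ∧
      (∀ x ∈ Icc 0 Λ, a * g x ^ 2 ≤ x) ∧
      (Summable fun k : ℤ => ‖cf k‖ * |(k : ℝ)|) ∧
      (Summable fun k : ℤ => ‖cg k‖ * |(k : ℝ)|) ∧
      (∀ x ∈ Icc 0 Λ, HasSum (fun k : ℤ => cf k * Complex.exp (Complex.I * ((k : ℝ) * ω * x)))
        ((f x : ℝ) : ℂ)) ∧
      (∀ x ∈ Icc 0 Λ, HasSum (fun k : ℤ => cg k * Complex.exp (Complex.I * ((k : ℝ) * ω * x)))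
        ((g x : ℝ) : ℂ)) := by
  -- the basic profiles
  set S : ℝ → ℝ := fun x => Real.smoothTransition ((x - a) / a) with hS
  set Fd : ℝ → ℝ := fun x => Real.cos (π / 2 * S x) with hFd
  set Gu : ℝ → ℝ := fun x => Real.sin (π / 2 * S x) with hGu
  have hSsm : ContDiff ℝ (⊤ : ℕ∞) S :=
    Real.smoothTransition.contDiff.comp ((contDiff_id.sub contDiff_const).div_const a)
  have hFdsm : ContDiff ℝ (⊤ : ℕ∞) Fd := Real.contDiff_cos.comp (contDiff_const.mul hSsm)
  have hGusm : ContDiff ℝ (⊤ : ℕ∞) Gu := Real.contDiff_sin.comp (contDiff_const.mul hSsm)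
  have hS0 : ∀ x, x ≤ a → S x = 0 := fun x hx =>
    Real.smoothTransition.zero_of_nonpos (div_nonpos_of_nonpos_of_nonneg (by linarith) ha.le)
  have hS1 : ∀ x, 2 * a ≤ x → S x = 1 := fun x hx =>
    Real.smoothTransition.one_of_one_le ((one_le_div ha).2 (by linarith))
  have hFd1 : ∀ x, x ≤ a → Fd x = 1 := fun x hx => by
    simp only [hFd, hS0 x hx, mul_zero, Real.cos_zero]
  have hFd0 : ∀ x, 2 * a ≤ x → Fd x = 0 := fun x hx => by
    simp only [hFd, hS1 x hx, mul_one, Real.cos_pi_div_two]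
  have hGu0 : ∀ x, x ≤ a → Gu x = 0 := fun x hx => by
    simp only [hGu, hS0 x hx, mul_zero, Real.sin_zero]
  -- the localised versions
  set f : ℝ → ℝ := fun x => Fd x * Fd (-x) with hf
  set g : ℝ → ℝ := fun x => Gu x * Fd (x - Λ - a) with hg
  have hfsm : ContDiff ℝ (⊤ : ℕ∞) f := hFdsm.mul (hFdsm.comp contDiff_neg)
  have hgsm : ContDiff ℝ (⊤ : ℕ∞) g :=
    hGusm.mul (hFdsm.comp ((contDiff_id.sub contDiff_const).sub contDiff_const))
  have hf_eq : ∀ x, 0 ≤ x → f x = Fd x := fun x hx => by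
    simp only [hf, hFd1 (-x) (by linarith), mul_one]
  have hg_eq : ∀ x, x ≤ Λ → g x = Gu x := fun x hx => by
    simp only [hg, hFd1 (x - Λ - a) (by linarith), mul_one]
  -- the window `[a₀, a₀ + T)` with `a₀ = -(Λ + 4a)`, `T = 2(Λ + 4a)`
  set a₀ : ℝ := -(Λ + 4 * a) with ha₀
  set T : ℝ := 2 * (Λ + 4 * a) with hT_def
  have hT : 0 < T := by positivity
  have haT : a₀ + T = Λ + 4 * a := by rw [ha₀, hT_def]; ring
  -- vanishing near the ends
  have hf0 : ∀ᶠ x in 𝓝 a₀, f x = 0 := by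
    filter_upwards [Iio_mem_nhds (show a₀ < -(2 * a) by rw [ha₀]; linarith)] with x hx
    rw [mem_Iio] at hx
    show Fd x * Fd (-x) = 0
    rw [hFd0 (-x) (by linarith), mul_zero]
  have hf1 : ∀ᶠ x in 𝓝 (a₀ + T), f x = 0 := by
    filter_upwards [Ioi_mem_nhds (show 2 * a < a₀ + T by rw [haT]; linarith)] with x hx
    rw [mem_Ioi] at hx
    show Fd x * Fd (-x) = 0
    rw [hFd0 x hx.le, zero_mul]
  have hg0 : ∀ᶠ x in 𝓝 a₀, g x = 0 := by
    filter_upwards [Iio_mem_nhds (show a₀ < a by rw [ha₀]; linarith)] with x hx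
    rw [mem_Iio] at hx
    show Gu x * Fd (x - Λ - a) = 0
    rw [hGu0 x hx.le, zero_mul]
  have hg1 : ∀ᶠ x in 𝓝 (a₀ + T), g x = 0 := by
    filter_upwards [Ioi_mem_nhds (show Λ + 3 * a < a₀ + T by rw [haT]; linarith)] with x hx
    rw [mem_Ioi] at hx
    show Gu x * Fd (x - Λ - a) = 0
    rw [hFd0 (x - Λ - a) (by linarith), mul_zero]
  obtain ⟨hfs, hfp⟩ := hcf_fourier_window hfsm hT hf0 hf1 (2 * π / T) rfl
  obtain ⟨hgs, hgp⟩ := hcf_fourier_window hgsm hT hg0 hg1 (2 * π / T) rfl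
  have hwin : ∀ x ∈ Icc (0 : ℝ) Λ, x ∈ Ico a₀ (a₀ + T) := fun x hx =>
    ⟨by rw [ha₀]; linarith [hx.1], by rw [haT]; linarith [hx.2]⟩
  refine ⟨f, g, _, _, 2 * π / T, ?_, ?_, ?_, hfs, hgs, fun x hx => hfp x (hwin x hx),
    fun x hx => hgp x (hwin x hx)⟩
  · intro x hx
    rw [hf_eq x hx.1, hg_eq x hx.2]
    simp only [hFd, hGu]
    exact Real.cos_sq_add_sin_sq _
  · intro x hx h2a
    rw [hf_eq x hx.1]
    exact hFd0 x h2a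
  · intro x hx
    rw [hg_eq x hx.2]
    by_cases hxa : x ≤ a
    · rw [hGu0 x hxa]
      simpa using hx.1
    · have hsin : Gu x ^ 2 ≤ 1 := by
        simp only [hGu]
        rw [sq_le_one_iff_abs_le_one]
        exact Real.abs_sin_le_one _
      have hxa' : a < x := lt_of_not_ge hxa
      nlinarith

end Plateau

end Summit.HubbardSuperconductivity.HubbardSuperconductivity.Theorems
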